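import Summits.BirchSwinnertonDyer.BirchSwinnertonDyer.Theorems.ThetaPartnerAtTwoSignedMainConjectureCMTwoRankZeroPTDeepSelmerTransport
import Summits.BirchSwinnertonDyer.BirchSwinnertonDyer.Theorems.ThetaPartnerAtTwoSignedMainConjectureCMTwoRankZeroPTDeepAdmissibleTransport
import Summits.BirchSwinnertonDyer.BirchSwinnertonDyer.Theorems.SchneiderFreeAdditiveX3PoitouTateUnramifiedOrthogonalAllLevels
import Summits.BirchSwinnertonDyer.BirchSwinnertonDyer.Theorems.ThetaPartnerAtTwoSignedMainConjectureCMTwoRankZeroPTDeepClose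
import Summits.BirchSwinnertonDyer.BirchSwinnertonDyer.Theorems.ThetaPartnerAtTwoSignedMainConjectureCMTwoRankZeroPTDeepLocalTransport
import Summits.BirchSwinnertonDyer.BirchSwinnertonDyer.Theorems.SchneiderFreeAdditiveX3PoitouTateReciprocitySumHolds
import Literature.NumberTheory.GaloisCohomology.PoitouTateSelmerStructuresCanonicalLift
import Literature.NumberTheory.EllipticCurves.GreenbergSelmer
import Literature.NumberTheory.EllipticCurves.BSDConductorProofs
import HarnessLib

/-!
# Route `ThetaPartnerAtTwo` (TP2), crux K2R0P♭ `SignedMainConjectureCMTwoRankZeroOfPubOfFlat` (item stmt-BirchSwinnertonDyer-26471), line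
# `rankzero` v20, stub `stub_poitouTateDeepTwo` — THE (E) SOCKET: hypothesis `hE` of the lead's closer
# `poitouTateDeepTwo_of_levelwise_of_badInertia` / `poitouTateDeepTwo_of_levelwise_exists` (…PTDeepClose(.OfE).lean) FROM THE TRANSFER (T) ALONE

Width seat `bsd-wall-tp2-p2-w3` g3 (cell `bsd-wall`). THEOREMS ONLY (no definition, no named fact, no instance declaration, no `sorry`);
closes no item; CONDITIONAL on the one displayed hypothesis `hT` (credit nothing); BSD is NOT proved by any of this.

## The theorem
`levelwisePoitouTate_of_transfer hT : <hE VERBATIM>` where `hT` is w2's TRANSFER brick (T) in layer currency: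
`∃ m₀, ∀ z, H(z) → ∀ n k b Q, [unr] → [bad] → [inf] → [kum] → 2^{m₀} z(Q) ≡ 0 (mod 2^k)` (B1 `kummerValue_eq_zero_of_signedSelmerLayer` + B5).
Everything else is a tree theorem: Poitou–Tate duality for Selmer structures with THE canonical local invariant maps
(`SchneiderFreeAdditiveX3.PoitouTateReduction.poitouTate_selmerStructure_duality_real_holds ℚ`, cell `bsd-schneider`, through the one-place
lift `LocalInvariants.exists_selmer_canonical_localTatePairing_eq_of_subgroup`), the inertia transport (E1a/d)
`admissible_of_forall_localization_shapiroLift_mem` (…PTDeepAdmissibleTransport.lean) and the decomposition-group transports (E1b/c)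
`resOfLe_decomp(Inf)_conjH1_eq_zero_of_localization_shapiroLift_eq_zero` (…PTDeepLocalTransport.lean).

## The proof (design memo PT-DEEP-HALF-DESIGN-w2g4 §2 (a)–(c), at the level `(n, k)`, `N = 2^k`)
`ρc := Maps(Γ_ℚ ⧸ Γ_n, A[2^k])` (`DiscreteGaloisModule.coind`), `S := {∞} ∪ {2} ∪ badPlaces(A)`, Selmer structures on `ρc`:
`𝓖` = relaxed on `S`, unramified outside; `𝓕 = 𝓖` except `𝓕_v := C^⊥` at THE place `v ∋ 2`, where `C := T_v(layerShapiro(layerKummer(E⁺(ℚ_{n,v}))))`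
(`exists_injective_dualTransport`); the character `χ_z : C → ℤ/2^k`, `T_v(Sh κ Q) ↦ 2^{m₀} z(Q) mod 2^k` (well defined:
`toZModPow_mul_eq_zero_of_layerKummer_eq_zero`, `T_v` and `Sh` injective); orthogonality `χ_z(loc_v y) = 0` for
`y ∈ H¹_{𝓕*}(ℚ, ρc^D)`: `y = H¹(Ψ)(Sh b)` (`existsUnique_shapiroLift_coindTateDual_eq`), the dual local conditions give `b` unramified outside `S`
(`UnramifiedOrthogonal` of THE maps, `unramifiedOrthogonal_of_isPerfect_allLevels`; transports `localization_mem_unramifiedSubgroup_of_coindTateDual` +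
(E1a/d)), locally trivial at the bad places and at `∞` (`⊤^⊥ = 0`: `eq_zero_of_forall_localTatePairingZMod_canonical(_inl)_eq_zero` +
`localization_eq_zero_of_localization_coindTateDual_eq_zero` + (E1b/c)) and with `layerLoc b = layerKummer Q` (the two pairing formulas
`localTatePairingZMod_canonical_localization_coindTateDual_shapiroLift` / `exists_injective_dualTransport` + non-degeneracy
`eq_zero_of_forall_invAt_cupProduct_pull_eq_zero`), whence (T) applies; then the ONE-PLACE LIFT gives `X ∈ H¹_𝓖(ℚ, ρc)` with
`⟨loc_v X, c⟩_v = χ_z(c)` on `C`; `c := Sh⁻¹ X` is admissible (E1a/d) and `CyclotomicLayer.layerPairingMod … c Q = ⟨loc_v X, T_v(Sh κ Q)⟩_v = 2^{m₀} z(Q)`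
(the dictionary `cohomologyMap_coindFinPull_localization_shapiroLift` + `layerPairingMod_apply`).

References: [MilneADT2006] I Cor. 2.3, Thm. 2.6, Thm. 2.13, Thm. 4.10 (b); [Howard2004HeegnerKolyvagin] Thm. 2.1.11; [Kobayashi2003]
(7.17)–(7.21), Thm. 7.3; [NeukirchSchmidtWingberg2008] I §6 Prop. (1.6.4).
-/

set_option autoImplicit false
-- the Theorems namespace of this sub repeats the summit name by design (D-0017 nested layout)
set_option linter.dupNamespace false

noncomputable section

open scoped Classical

namespace Summit.BirchSwinnertonDyer.BirchSwinnertonDyer.Theorems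

namespace SignedLowerOffTwo.PTDeep

open CategoryTheory Field NumberField IsDedekindDomain WeierstrassCurve
  Literature.NumberTheory.EllipticCurves Literature.NumberTheory.EllipticCurves.CyclotomicLayer
  Literature.NumberTheory.EllipticCurves.Kobayashi2003 Literature.NumberTheory.EllipticCurves.Sprung2012
  Literature.NumberTheory.EllipticCurves.GreenbergSelmer Literature.NumberTheory.EllipticCurves.Rank1Residual
  Literature.NumberTheory.EllipticCurves.Kato2004 Literature.NumberTheory.EllipticCurves.Kato2004.EulerSystemValues
  Literature.NumberTheory.GaloisRepresentations Literature.NumberTheory.GaloisRepresentations.DiscreteGaloisModule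
  Literature.NumberTheory.GaloisCohomology ZpExtension Rat.HeightOneSpectrum Summit.BirchSwinnertonDyer.Rank1Residual.Supersingular

-- Cup products need `LocallyCompactSpace Γ`; as in the K3 layer files the compactness of absolute Galois groups is a local instance only;
-- `E[N]` is finite (local instance, as in `CyclotomicLayerTatePairing.lean`).
attribute [local instance] absoluteGaloisGroup_compactSpace finite_geomTorsion_of_neZero

-- one `(n, k)`-level assembly of five bricks in a single declaration; the statement alone (hypothesis `hE` verbatim) is ~60 lines
set_option maxHeartbeats 400000 in
/-- **Hypothesis (E) of the (S_PT) stub-closer from the transfer (T)** (Poitou–Tate for Selmer structures with THE canonical maps,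
the Shapiro dictionary and the transports (E1) being tree theorems). See the module docstring for the construction. CONDITIONAL on `hT`;
credit nothing.
[cite: MilneADT2006, Ch. I, Thm. 4.10(b)] [cite: Howard2004HeegnerKolyvagin, Thm. 2.1.11 (arXiv:1202.6340 p. 6)]
[cite: Kobayashi2003, (7.17)–(7.21), Thm. 7.3 (pp. 12–13)] -/
theorem levelwisePoitouTate_of_transfer
    (hT : ∀ (v : HeightOneSpectrum (𝓞 ℚ)), ((2 : ℕ) : 𝓞 ℚ) ∈ v.asIdeal →
      ∀ (A : WeierstrassCurve ℚ) [A.IsElliptic] [A.IsGloballyMinimal],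
        A.HasCM → A.analyticRank = 0 → GoodSS A 2 → A.frobeniusTrace 2 = 0 →
        ∀ (κ : ZpExtension ℚ 2), κ.IsCyclotomic →
        ∃ m₀ : ℕ,
          ∀ z : localTowerPointsOfEmb κ (closureEmb (K := ℚ) (v.adicCompletion ℚ)) A →+ ℤ_[2],
            (∀ (t : A.subgroupH1 2 κ.kerSubgroup), t ∈ signedSelmerInfty A κ 1 →
              ∀ (φ : contOneCocycles (discreteTopRep κ.kerSubgroup (A.geomPrimaryTorsion 2)))
                (Q : localPoints A (v.adicCompletion ℚ)) (k : ℕ), oneCocycleClass _ φ = t →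
              ∀ hQ : 2 ^ k • Q ∈ (⨆ n, signedLocalPoints κ (v.adicCompletion ℚ) A 1 n),
              (∀ τ : localSubgroupOfEmb κ.kerSubgroup (closureEmb (K := ℚ) (v.adicCompletion ℚ)),
                pointsMapOfEmb A (closureEmb (K := ℚ) (v.adicCompletion ℚ))
                    ((φ.1 (resGalSubgroupOfEmb κ.kerSubgroup _ τ) : A.geomPrimaryTorsion 2) : A.geomPoints) =
                  (τ : Field.absoluteGaloisGroup (v.adicCompletion ℚ)) • Q - Q) →
              (PadicInt.toZModPow k
                  (z ⟨2 ^ k • Q, SignedKatoOffTwo.KummerPoint.iSup_signedLocalPoints_le_localTowerPointsOfEmb A 2 κ 1 v hQ⟩)).val •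
                ((((2 : ℚ) ^ k)⁻¹ : ℚ) : AddCircle (1 : ℚ)) = 0) →
            ∀ (n k : ℕ) (b : A.torsionH1Over ((2 : ℤ) ^ k) (κ.layerSubgroup n)) (Q : localPoints A (v.adicCompletion ℚ))
              (hQ : Q ∈ signedLocalPointsOfEmb κ (closureEmb (K := ℚ) (v.adicCompletion ℚ)) A 1 n),
              -- [unr] unramified outside `S_A`
              (∀ w : HeightOneSpectrum (𝓞 ℚ), w ∉ ({u : HeightOneSpectrum (𝓞 ℚ) | ((2 : ℕ) : 𝓞 ℚ) ∈ u.asIdeal} ∪ A.badPlaces (𝓞 ℚ)) →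
                ∀ 𝔓 ∈ w.primesAbove,
                  resLe (A.torsionGaloisModule ((2 : ℤ) ^ k)).toTopRep
                    (inf_le_left : κ.layerSubgroup n ⊓ 𝔓.inertia (absoluteGaloisGroup ℚ) ≤ κ.layerSubgroup n) 1 b = 0) →
              -- [bad] locally trivial at the bad odd places (all conjugates)
              (∀ w ∈ A.badPlaces (𝓞 ℚ), ((2 : ℕ) : 𝓞 ℚ) ∉ w.asIdeal → ∀ σ : absoluteGaloisGroup ℚ,
                resOfLe (geomTorsion A ((2 : ℤ) ^ k)) (inf_le_left : κ.layerSubgroup n ⊓ decomp w ≤ κ.layerSubgroup n)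
                  (conjH1 (κ.layerSubgroup n) (geomTorsion A ((2 : ℤ) ^ k)) σ b) = 0) →
              -- [inf] locally trivial at the infinite place (all conjugates)
              (∀ (w : InfinitePlace ℚ) (σ : absoluteGaloisGroup ℚ),
                resOfLe (geomTorsion A ((2 : ℤ) ^ k)) (inf_le_left : κ.layerSubgroup n ⊓ decompInf w ≤ κ.layerSubgroup n)
                  (conjH1 (κ.layerSubgroup n) (geomTorsion A ((2 : ℤ) ^ k)) σ b) = 0) →
              -- [kum] the layer localisation at `v` is the Kummer class of `Q`
              layerLoc A (2 ^ k) κ v n b = layerKummer A (2 ^ k) κ v n ⟨Q, signedLocalPointsOfEmb_le κ _ A 1 n hQ⟩ →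
              PadicInt.toZModPow k ((2 : ℤ_[2]) ^ m₀ *
                z ⟨Q, localLayerPointsOfEmb_le_localTowerPointsOfEmb κ _ A n (signedLocalPointsOfEmb_le κ _ A 1 n hQ)⟩) = 0) :
    ∀ (v : HeightOneSpectrum (𝓞 ℚ)), ((2 : ℕ) : 𝓞 ℚ) ∈ v.asIdeal →
      ∀ (A : WeierstrassCurve ℚ) [A.IsElliptic] [A.IsGloballyMinimal],
        A.HasCM → A.analyticRank = 0 → GoodSS A 2 → A.frobeniusTrace 2 = 0 →
        ∀ (κ : ZpExtension ℚ 2) (γ : Field.absoluteGaloisGroup ℚ),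
          κ.IsCyclotomic → κ.IsTopGenerator γ →
        ∀ [ContinuousSMul ℤ_[2] (A.tateModule 2)]
          (pair : ∀ n : ℕ, H1 (tateRep A 2) (κ.layerSubgroup n) →ₗ[ℤ_[2]]
            (localLayerPointsOfEmb κ (closureEmb (K := ℚ) (v.adicCompletion ℚ)) A n →+ ℤ_[2])),
          (∀ (n k : ℕ) (x : H1 (tateRep A 2) (κ.layerSubgroup n))
            (Q : localLayerPointsOfEmb κ (closureEmb (K := ℚ) (v.adicCompletion ℚ)) A n),
            PadicInt.toZModPow k (pair n x Q) = CyclotomicLayer.tatePairingPk A κ v n k x Q) →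
        ∃ m₀ : ℕ,
          ∀ z : localTowerPointsOfEmb κ (closureEmb (K := ℚ) (v.adicCompletion ℚ)) A →+ ℤ_[2],
            (∀ (t : A.subgroupH1 2 κ.kerSubgroup), t ∈ signedSelmerInfty A κ 1 →
              ∀ (φ : contOneCocycles (discreteTopRep κ.kerSubgroup (A.geomPrimaryTorsion 2)))
                (Q : localPoints A (v.adicCompletion ℚ)) (k : ℕ), oneCocycleClass _ φ = t →
              ∀ hQ : 2 ^ k • Q ∈ (⨆ n, signedLocalPoints κ (v.adicCompletion ℚ) A 1 n),
              (∀ τ : localSubgroupOfEmb κ.kerSubgroup (closureEmb (K := ℚ) (v.adicCompletion ℚ)),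
                pointsMapOfEmb A (closureEmb (K := ℚ) (v.adicCompletion ℚ))
                    ((φ.1 (resGalSubgroupOfEmb κ.kerSubgroup _ τ) : A.geomPrimaryTorsion 2) : A.geomPoints) =
                  (τ : Field.absoluteGaloisGroup (v.adicCompletion ℚ)) • Q - Q) →
              (PadicInt.toZModPow k
                  (z ⟨2 ^ k • Q, SignedKatoOffTwo.KummerPoint.iSup_signedLocalPoints_le_localTowerPointsOfEmb A 2 κ 1 v hQ⟩)).val •
                ((((2 : ℚ) ^ k)⁻¹ : ℚ) : AddCircle (1 : ℚ)) = 0) →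
            ∀ n k : ℕ, ∃ c : A.torsionH1Over ((2 : ℤ) ^ k) (κ.layerSubgroup n),
              (∀ w : HeightOneSpectrum (𝓞 ℚ), w ∉ ({u : HeightOneSpectrum (𝓞 ℚ) | ((2 : ℕ) : 𝓞 ℚ) ∈ u.asIdeal} ∪ A.badPlaces (𝓞 ℚ)) →
                ∀ 𝔓 ∈ w.primesAbove,
                  resLe (A.torsionGaloisModule ((2 : ℤ) ^ k)).toTopRep
                    (inf_le_left : κ.layerSubgroup n ⊓ 𝔓.inertia (absoluteGaloisGroup ℚ) ≤ κ.layerSubgroup n) 1 c = 0) ∧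
              ∀ (Q : localPoints A (v.adicCompletion ℚ))
                (hQ : Q ∈ signedLocalPointsOfEmb κ (closureEmb (K := ℚ) (v.adicCompletion ℚ)) A 1 n),
                CyclotomicLayer.layerPairingMod A (2 ^ k) (CyclotomicLayer.weilTowerPk A k) (CyclotomicLayer.weilTowerPk_pow A k)
                    (CyclotomicLayer.weilTowerPk_add_left A k) (CyclotomicLayer.weilTowerPk_add_right A k)
                    (CyclotomicLayer.weilTowerPk_smul A k) κ v n c ⟨Q, signedLocalPointsOfEmb_le κ _ A 1 n hQ⟩ =
                  PadicInt.toZModPow k ((2 : ℤ_[2]) ^ m₀ *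
                    z ⟨Q, localLayerPointsOfEmb_le_localTowerPointsOfEmb κ _ A n (signedLocalPointsOfEmb_le κ _ A 1 n hQ)⟩) := by
  intro v hv A _ _ hcm hr hss ha κ γ hκ hγ _ pair hP3
  obtain ⟨m₀, hm₀⟩ := hT v hv A hcm hr hss ha κ hκ
  refine ⟨m₀, fun z hz n k => ?_⟩
  /- ### Level `(n, k)`: representatives of `Γ_ℚ ⧸ Γ_n`, THE Weil pairing `e_{2^k}`, the dual transport `T_v` -/
  haveI : NeZero (2 ^ k) := ⟨pow_ne_zero k two_ne_zero⟩
  haveI : (κ.layerSubgroup n).FiniteIndex := finiteIndex_of_isOpen_of_compactSpace _ (κ.isOpen_layerSubgroup n)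
  letI : Fintype (absoluteGaloisGroup ℚ ⧸ κ.layerSubgroup n) := Fintype.ofFinite _
  obtain ⟨s, hs, hs1⟩ := exists_reps_one (κ.layerSubgroup n)
  let ι := closureEmb (K := ℚ) (v.adicCompletion ℚ)
  -- (the module `ρ = A[2^k]` is spelled `A.torsionGaloisModule ((2 ^ k : ℕ) : ℤ)` throughout — definitionally the `(2:ℤ)^k` of `hE`;
  --  `ρc = Maps(Γ_ℚ ⧸ Γ_n, A[2^k]) = ρ.coind Γ_n`, `Sh = shapiroLift ρ Γ_n`, `Ψ = coindTateDualMor ρ ρ Γ_n (weilPairingHom …)`)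
  have hnondeg : ∀ T : geomTorsion A (2 ^ k), (∀ S, weilTowerPk (p := 2) A k S T = 1) → T = 0 :=
    weilTowerPk_nondegenerate A k
  obtain ⟨Tv, hTinj, hTpair⟩ := exists_injective_dualTransport A (2 ^ k) (weilTowerPk (p := 2) A k) (weilTowerPk_pow A k)
    (weilTowerPk_add_left A k) (weilTowerPk_add_right A k) (weilTowerPk_smul A k) κ v hκ hv hnondeg n
  have hM : ∀ m : absoluteGaloisGroup ℚ ⧸ κ.layerSubgroup n → geomTorsion A (2 ^ k : ℕ), (2 ^ k) • m = 0 := fun φ =>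
    funext fun y => AddSubgroup.torsionBy.nsmul (φ y)
  /- ### `E⁺_n`, the classes `c_Q = T_v (Sh_v (κ Q))`, the subgroup `C` and the character `χ_z` -/
  let Eplus : AddSubgroup (localLayerPointsOfEmb κ ι A n) := (signedLocalPointsOfEmb κ ι A 1 n).comap (AddSubgroup.subtype _)
  let fE : Eplus →+ galoisCohomology
      ((((A.torsionGaloisModule ((2 ^ k : ℕ) : ℤ)).coind (κ.layerSubgroup n) (κ.isOpen_layerSubgroup n)).tateDual (2 ^ k)).toLocal
        (Sum.inr v)) 1 :=
    (Tv.comp ((layerShapiro A (2 ^ k) κ v n).toAddMonoidHom.comp (layerKummer A (2 ^ k) κ v n))).comp Eplus.subtype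
  let C := fE.range
  let χ₀ : Eplus →+ ZMod (2 ^ k) :=
    (PadicInt.toZModPow k).toAddMonoidHom.comp ((AddMonoidHom.mulLeft ((2 : ℤ_[2]) ^ m₀)).comp
      (z.comp ((AddSubgroup.inclusion (localLayerPointsOfEmb_le_localTowerPointsOfEmb κ ι A n)).comp Eplus.subtype)))
  have hχ₀ : ∀ Q : Eplus, χ₀ Q = PadicInt.toZModPow k ((2 : ℤ_[2]) ^ m₀ *
      z ⟨(Q : localLayerPointsOfEmb κ ι A n), localLayerPointsOfEmb_le_localTowerPointsOfEmb κ _ A n (Q : localLayerPointsOfEmb κ ι A n).2⟩) :=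
    fun Q => rfl
  -- `χ₀` kills the kernel of `fE` (the Kummer kernel `2^k·E(ℚ_{n,v})`)
  have hker : ∀ Q : Eplus, fE Q = 0 → χ₀ Q = 0 := by
    intro Q hQ
    have h1 : layerShapiro A (2 ^ k) κ v n (layerKummer A (2 ^ k) κ v n (Q : localLayerPointsOfEmb κ ι A n)) = 0 :=
      hTinj (by rw [map_zero]; exact hQ)
    have h2 : layerKummer A (2 ^ k) κ v n (Q : localLayerPointsOfEmb κ ι A n) = 0 :=
      shapiroLift_injective _ _ _ _ _ (by rw [map_zero]; exact h1)
    rw [hχ₀]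
    exact toZModPow_mul_eq_zero_of_layerKummer_eq_zero A (2 ^ k) κ v n k m₀ rfl z _ (Q : localLayerPointsOfEmb κ ι A n).2 h2
  have hker' : fE.ker ≤ χ₀.ker := fun Q hQ => (AddMonoidHom.mem_ker).mpr (hker Q ((AddMonoidHom.mem_ker).mp hQ))
  let eqv : Eplus ⧸ fE.ker ≃+ fE.range := QuotientAddGroup.quotientKerEquivRange fE
  let χ : C →+ ZMod (2 ^ k) := (QuotientAddGroup.lift fE.ker χ₀ hker').comp eqv.symm.toAddMonoidHom
  have hχval : ∀ Q : Eplus, χ ⟨fE Q, ⟨Q, rfl⟩⟩ = χ₀ Q := by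
    intro Q
    have heq : eqv (QuotientAddGroup.mk Q) = ⟨fE Q, ⟨Q, rfl⟩⟩ := rfl
    change QuotientAddGroup.lift fE.ker χ₀ hker' (eqv.symm ⟨fE Q, ⟨Q, rfl⟩⟩) = χ₀ Q
    rw [← heq, AddEquiv.symm_apply_apply, QuotientAddGroup.lift_mk]
  /- ### The finite set `S = {∞} ∪ {2} ∪ bad` and the Selmer structures `𝓕 ≤ 𝓖` on `ρc` -/
  have hSfin : ({u : HeightOneSpectrum (𝓞 ℚ) | ((2 : ℕ) : 𝓞 ℚ) ∈ u.asIdeal} ∪ A.badPlaces (𝓞 ℚ)).Finite := by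
    refine Set.Finite.union ?_ (A.finite_badPlaces_holds (𝓞 ℚ))
    have h2ne : ((2 : ℕ) : 𝓞 ℚ) ≠ 0 := by exact_mod_cast (two_ne_zero : (2 : ℕ) ≠ 0)
    have hne : Ideal.span {((2 : ℕ) : 𝓞 ℚ)} ≠ ⊥ := fun h ↦ h2ne (Ideal.span_singleton_eq_bot.mp h)
    refine (Ideal.finite_factors hne).subset fun w hw ↦ ?_
    simp only [Set.mem_setOf_eq] at hw ⊢
    exact Ideal.dvd_iff_le.mpr ((Ideal.span_singleton_le_iff_mem _).mpr hw)
  let S : Finset (Place ℚ) := (Finset.univ : Finset (InfinitePlace ℚ)).image Sum.inl ∪ hSfin.toFinset.image Sum.inr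
  have hSinl : ∀ w : InfinitePlace ℚ, (Sum.inl w : Place ℚ) ∈ S := fun w =>
    Finset.mem_union_left _ (Finset.mem_image_of_mem _ (Finset.mem_univ w))
  have hSinr : ∀ w : HeightOneSpectrum (𝓞 ℚ), (Sum.inr w : Place ℚ) ∈ S ↔
      w ∈ ({u : HeightOneSpectrum (𝓞 ℚ) | ((2 : ℕ) : 𝓞 ℚ) ∈ u.asIdeal} ∪ A.badPlaces (𝓞 ℚ)) := by
    intro w
    constructor
    · intro h
      rcases Finset.mem_union.mp h with h | h
      · obtain ⟨w', -, hw'⟩ := Finset.mem_image.mp h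
        exact absurd hw' Sum.inl_ne_inr
      · obtain ⟨w', hw', heq⟩ := Finset.mem_image.mp h
        rw [← Sum.inr_injective heq]
        exact hSfin.mem_toFinset.mp hw'
    · exact fun h => Finset.mem_union_right _ (Finset.mem_image_of_mem _ (hSfin.mem_toFinset.mpr h))
  have hvS : v ∈ ({u : HeightOneSpectrum (𝓞 ℚ) | ((2 : ℕ) : 𝓞 ℚ) ∈ u.asIdeal} ∪ A.badPlaces (𝓞 ℚ)) :=
    Set.mem_union_left _ (hv : v ∈ {u : HeightOneSpectrum (𝓞 ℚ) | ((2 : ℕ) : 𝓞 ℚ) ∈ u.asIdeal})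
  have hv₀ : (Sum.inr v : Place ℚ) ∈ S := (hSinr v).mpr hvS
  -- `𝓖`: everything on `S`, unramified outside
  let 𝓖 : SelmerStructure ((A.torsionGaloisModule ((2 ^ k : ℕ) : ℤ)).coind (κ.layerSubgroup n) (κ.isOpen_layerSubgroup n)) :=
    fun w => match w with
      | Sum.inl _ => ⊤
      | Sum.inr u => if u ∈ ({u : HeightOneSpectrum (𝓞 ℚ) | ((2 : ℕ) : 𝓞 ℚ) ∈ u.asIdeal} ∪ A.badPlaces (𝓞 ℚ)) then ⊤ else
          unramifiedSubgroup (GaloisRep.toLocal u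
            ((A.torsionGaloisModule ((2 ^ k : ℕ) : ℤ)).coind (κ.layerSubgroup n) (κ.isOpen_layerSubgroup n))) 1
  have h𝓖inl : ∀ w : InfinitePlace ℚ, 𝓖 (Sum.inl w) = ⊤ := fun _ => rfl
  have h𝓖S : ∀ u ∈ ({u : HeightOneSpectrum (𝓞 ℚ) | ((2 : ℕ) : 𝓞 ℚ) ∈ u.asIdeal} ∪ A.badPlaces (𝓞 ℚ)), 𝓖 (Sum.inr u) = ⊤ :=
    fun u hu => if_pos hu
  have h𝓖nS : ∀ u ∉ ({u : HeightOneSpectrum (𝓞 ℚ) | ((2 : ℕ) : 𝓞 ℚ) ∈ u.asIdeal} ∪ A.badPlaces (𝓞 ℚ)), 𝓖 (Sum.inr u) =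
      unramifiedSubgroup (GaloisRep.toLocal u
        ((A.torsionGaloisModule ((2 ^ k : ℕ) : ℤ)).coind (κ.layerSubgroup n) (κ.isOpen_layerSubgroup n))) 1 :=
    fun u hu => if_neg hu
  -- `C^⊥` for THE local Tate pairing at `v`
  let Cperp : AddSubgroup (galoisCohomology
      (((A.torsionGaloisModule ((2 ^ k : ℕ) : ℤ)).coind (κ.layerSubgroup n) (κ.isOpen_layerSubgroup n)).toLocal (Sum.inr v)) 1) :=
    { carrier := {a | ∀ c ∈ C, localTatePairingZMod
          ((A.torsionGaloisModule ((2 ^ k : ℕ) : ℤ)).coind (κ.layerSubgroup n) (κ.isOpen_layerSubgroup n)) (2 ^ k) (Sum.inr v)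
          (LocalInvariants.canonical ℚ (2 ^ k) (Sum.inr v)) a c = 0}
      zero_mem' := fun c _ => by simp only [map_zero, AddMonoidHom.zero_apply]
      add_mem' := fun {a b} ha hb c hc => by simp only [map_add, AddMonoidHom.add_apply, ha c hc, hb c hc, add_zero]
      neg_mem' := fun {a} ha c hc => by simp only [map_neg, AddMonoidHom.neg_apply, ha c hc, neg_zero] }
  -- `𝓕`: `𝓖` with `𝓕_v := C^⊥`
  let 𝓕 : SelmerStructure ((A.torsionGaloisModule ((2 ^ k : ℕ) : ℤ)).coind (κ.layerSubgroup n) (κ.isOpen_layerSubgroup n)) :=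
    Function.update 𝓖 (Sum.inr v) Cperp
  have h𝓕v : 𝓕 (Sum.inr v) = Cperp := Function.update_self _ _ _
  have h𝓕ne : ∀ w : Place ℚ, w ≠ Sum.inr v → 𝓕 w = 𝓖 w := fun w hw => Function.update_of_ne hw _ _
  have hle : 𝓕 ≤ 𝓖 := by
    intro w
    rcases eq_or_ne w (Sum.inr v) with rfl | hw
    · rw [h𝓕v, h𝓖S v hvS]; exact le_top
    · rw [h𝓕ne w hw]
  have h𝓖 : 𝓖.IsUnramifiedOutside S :=
    ⟨hSinl, fun u hu => h𝓖nS u fun h => hu ((hSinr u).mpr h)⟩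
  have h𝓕 : 𝓕.IsUnramifiedOutside S := by
    refine ⟨hSinl, fun u hu => ?_⟩
    have hne : (Sum.inr u : Place ℚ) ≠ Sum.inr v := fun h => hu (by rw [h]; exact hv₀)
    rw [h𝓕ne _ hne]
    exact h𝓖nS u fun h => hu ((hSinr u).mpr h)
  have hS' : ∀ u : HeightOneSpectrum (𝓞 ℚ), (Sum.inr u : Place ℚ) ∉ S →
      ((2 ^ k : ℕ) : 𝓞 ℚ) ∉ u.asIdeal ∧
        GaloisRep.IsUnramifiedAt u ((A.torsionGaloisModule ((2 ^ k : ℕ) : ℤ)).coind (κ.layerSubgroup n) (κ.isOpen_layerSubgroup n)) := by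
    intro u hu
    have hu' : u ∉ ({u : HeightOneSpectrum (𝓞 ℚ) | ((2 : ℕ) : 𝓞 ℚ) ∈ u.asIdeal} ∪ A.badPlaces (𝓞 ℚ)) :=
      fun h => hu ((hSinr u).mpr h)
    obtain ⟨h2, hgood⟩ := not_mem_and_hasGoodReductionAt_of_not_mem_union (A := A) (p := 2) hu'
    refine ⟨fun h => h2 (u.isPrime.mem_of_pow_mem k ?_), ?_⟩
    · rw [← Nat.cast_pow]; exact h
    · exact isUnramifiedAt_coind_torsionGaloisModule_layerSubgroup (W := A) (κ := κ) n k h2 hgood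
  have h𝓖v : 𝓖 (Sum.inr v) = ⊤ := h𝓖S v hvS
  have h𝓕v' : ∀ a, a ∈ 𝓕 (Sum.inr v) ↔ ∀ c ∈ C, localTatePairingZMod
      ((A.torsionGaloisModule ((2 ^ k : ℕ) : ℤ)).coind (κ.layerSubgroup n) (κ.isOpen_layerSubgroup n)) (2 ^ k) (Sum.inr v)
      (LocalInvariants.canonical ℚ (2 ^ k) (Sum.inr v)) a c = 0 := fun a => by rw [h𝓕v]; rfl
  /- ### Orthogonality: `χ_z` kills `loc_v y` for every `y ∈ H¹_{𝓕^*}(ℚ, ρc^D)` — (E1) + (T) -/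
  have hχ : ∀ y ∈ ((LocalInvariants.canonical ℚ (2 ^ k)).dualSelmerStructure
        ((A.torsionGaloisModule ((2 ^ k : ℕ) : ℤ)).coind (κ.layerSubgroup n) (κ.isOpen_layerSubgroup n)) 𝓕).selmerGroup,
      ∀ hy : galoisCohomology.localization
          (((A.torsionGaloisModule ((2 ^ k : ℕ) : ℤ)).coind (κ.layerSubgroup n) (κ.isOpen_layerSubgroup n)).tateDual (2 ^ k))
          (Sum.inr v) 1 y ∈ C,
        χ ⟨galoisCohomology.localization
          (((A.torsionGaloisModule ((2 ^ k : ℕ) : ℤ)).coind (κ.layerSubgroup n) (κ.isOpen_layerSubgroup n)).tateDual (2 ^ k))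
          (Sum.inr v) 1 y, hy⟩ = 0 := by
    intro y hy hyC
    -- `y = H¹(Ψ) (Sh b)`
    obtain ⟨b, hb, -⟩ := existsUnique_shapiroLift_coindTateDual_eq A (2 ^ k) (weilTowerPk (p := 2) A k) (weilTowerPk_pow A k)
      (weilTowerPk_add_left A k) (weilTowerPk_add_right A k) (weilTowerPk_smul A k) κ hnondeg n hs hs1 y
    subst hb
    -- `loc_v y = fE Q₀`, `Q₀ ∈ E⁺_n`
    obtain ⟨Q₀, hQ₀⟩ := AddMonoidHom.mem_range.mp hyC
    have hyC' : (⟨_, hyC⟩ : C) = ⟨fE Q₀, ⟨Q₀, rfl⟩⟩ := Subtype.ext hQ₀.symm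
    rw [hyC', hχval, hχ₀]
    have hyloc := (SelmerStructure.mem_selmerGroup_iff _ _).mp hy
    -- [unr] `b` is admissible (Milne I 2.6 for THE maps + the inertia transport (E1a/d))
    have hunr : ∀ w : HeightOneSpectrum (𝓞 ℚ),
        w ∉ ({u : HeightOneSpectrum (𝓞 ℚ) | ((2 : ℕ) : 𝓞 ℚ) ∈ u.asIdeal} ∪ A.badPlaces (𝓞 ℚ)) → ∀ 𝔓 ∈ w.primesAbove,
          resLe (A.torsionGaloisModule ((2 : ℤ) ^ k)).toTopRep
            (inf_le_left : κ.layerSubgroup n ⊓ 𝔓.inertia (absoluteGaloisGroup ℚ) ≤ κ.layerSubgroup n) 1 b = 0 := by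
      refine admissible_of_forall_localization_shapiroLift_mem (A := A) (p := 2) (κ := κ) n k hs hs1 b fun w hw => ?_
      have hwS : (Sum.inr w : Place ℚ) ∉ S := fun h => hw ((hSinr w).mp h)
      have hne : (Sum.inr w : Place ℚ) ≠ Sum.inr v := fun h => hwS (by rw [h]; exact hv₀)
      have h1 := hyloc (Sum.inr w)
      rw [LocalInvariants.dualSelmerStructure_apply, h𝓕ne _ hne, h𝓖nS w hw,
        (SchneiderFreeAdditiveX3.PoitouTateReduction.unramifiedOrthogonal_of_isPerfect_allLevels
          (LocalInvariants.canonical ℚ (2 ^ k)) LocalInvariants.canonical_isPerfect _ hM w (hS' w hwS).1 (hS' w hwS).2).1] at h1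
      exact localization_mem_unramifiedSubgroup_of_coindTateDual A (2 ^ k) (weilTowerPk (p := 2) A k) (weilTowerPk_pow A k)
        (weilTowerPk_add_left A k) (weilTowerPk_add_right A k) (weilTowerPk_smul A k) (κ.layerSubgroup n)
        (κ.isOpen_layerSubgroup n) hnondeg w _ h1
    -- [bad] `b` is locally trivial at the bad odd places (`⊤^⊥ = 0` + (E1b))
    have hbad : ∀ w ∈ A.badPlaces (𝓞 ℚ), ((2 : ℕ) : 𝓞 ℚ) ∉ w.asIdeal → ∀ σ : absoluteGaloisGroup ℚ,
        resOfLe (geomTorsion A ((2 : ℤ) ^ k)) (inf_le_left : κ.layerSubgroup n ⊓ decomp w ≤ κ.layerSubgroup n)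
          (conjH1 (κ.layerSubgroup n) (geomTorsion A ((2 : ℤ) ^ k)) σ b) = 0 := by
      intro w hwbad hw2
      have hne : (Sum.inr w : Place ℚ) ≠ Sum.inr v := fun h => hw2 (by rw [Sum.inr_injective h]; exact hv)
      have h1 := hyloc (Sum.inr w)
      rw [LocalInvariants.dualSelmerStructure_apply, h𝓕ne _ hne, h𝓖S w (Set.mem_union_right _ hwbad),
        LocalInvariants.mem_dualLocalCondition_iff] at h1
      have h2 := eq_zero_of_forall_localTatePairingZMod_canonical_eq_zero (2 ^ k) _ hM w _ fun a => h1 a (AddSubgroup.mem_top a)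
      exact fun σ => resOfLe_decomp_conjH1_eq_zero_of_localization_shapiroLift_eq_zero A _ κ n hs hs1 w b
        (localization_eq_zero_of_localization_coindTateDual_eq_zero A (2 ^ k) (weilTowerPk (p := 2) A k) (weilTowerPk_pow A k)
          (weilTowerPk_add_left A k) (weilTowerPk_add_right A k) (weilTowerPk_smul A k) (κ.layerSubgroup n)
          (κ.isOpen_layerSubgroup n) hnondeg (Sum.inr w) _ h2) σ
    -- [inf] `b` is locally trivial at the infinite place (`⊤^⊥ = 0`, Milne I 2.13 + (E1c))
    have hinf : ∀ (w : InfinitePlace ℚ) (σ : absoluteGaloisGroup ℚ),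
        resOfLe (geomTorsion A ((2 : ℤ) ^ k)) (inf_le_left : κ.layerSubgroup n ⊓ decompInf w ≤ κ.layerSubgroup n)
          (conjH1 (κ.layerSubgroup n) (geomTorsion A ((2 : ℤ) ^ k)) σ b) = 0 := by
      intro w
      have h1 := hyloc (Sum.inl w)
      rw [LocalInvariants.dualSelmerStructure_apply, h𝓕ne _ Sum.inl_ne_inr, h𝓖inl w,
        LocalInvariants.mem_dualLocalCondition_iff] at h1
      have h2 := eq_zero_of_forall_localTatePairingZMod_canonical_inl_eq_zero (2 ^ k) _ hM w _
        fun a => h1 a (AddSubgroup.mem_top a)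
      exact fun σ => resOfLe_decompInf_conjH1_eq_zero_of_localization_shapiroLift_eq_zero A _ κ n hs hs1 w b
        (localization_eq_zero_of_localization_coindTateDual_eq_zero A (2 ^ k) (weilTowerPk (p := 2) A k) (weilTowerPk_pow A k)
          (weilTowerPk_add_left A k) (weilTowerPk_add_right A k) (weilTowerPk_smul A k) (κ.layerSubgroup n)
          (κ.isOpen_layerSubgroup n) hnondeg (Sum.inl w) _ h2) σ
    -- [kum] the layer localisation of `b` at `v` is the Kummer class of `Q₀` (characters + non-degeneracy of the layer pairing)
    have hkum : layerLoc A (2 ^ k) κ v n b = layerKummer A (2 ^ k) κ v n (Q₀ : localLayerPointsOfEmb κ ι A n) := by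
      have hsub : layerShapiro A (2 ^ k) κ v n (layerLoc A (2 ^ k) κ v n b) -
          layerShapiro A (2 ^ k) κ v n (layerKummer A (2 ^ k) κ v n (Q₀ : localLayerPointsOfEmb κ ι A n)) = 0 := by
        refine eq_zero_of_forall_invAt_cupProduct_pull_eq_zero A (2 ^ k) (weilTowerPk (p := 2) A k) (weilTowerPk_pow A k)
          (weilTowerPk_add_left A k) (weilTowerPk_add_right A k) (weilTowerPk_smul A k) κ v hκ hv hnondeg n _ fun a' => ?_
        rw [map_sub, map_sub,
          ← localTatePairingZMod_canonical_localization_coindTateDual_shapiroLift A (2 ^ k) (weilTowerPk (p := 2) A k)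
            (weilTowerPk_pow A k) (weilTowerPk_add_left A k) (weilTowerPk_add_right A k) (weilTowerPk_smul A k) κ v hκ hv n
            hs hs1 a' b,
          ← hTpair, ← hQ₀]
        exact sub_self _
      rw [← map_sub] at hsub
      exact sub_eq_zero.mp (shapiroLift_injective _ _ _ _ _ (hsub.trans (map_zero _).symm))
    -- (T)
    exact hm₀ z hz n k b _ Q₀.2 hunr hbad hinf hkum
  /- ### The one-place lift (Milne I 4.10 (b) for THE maps) and the output class `c = Sh⁻¹ X` -/
  obtain ⟨X, hX𝓖, hXval, -⟩ :=
    LocalInvariants.exists_selmer_canonical_localTatePairing_eq_of_subgroup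
      (SchneiderFreeAdditiveX3.PoitouTateReduction.poitouTate_selmerStructure_duality_real_holds ℚ) _ hM hS' hle h𝓕 h𝓖 hv₀ h𝓖v
      C h𝓕v' χ hχ
  obtain ⟨c, hc⟩ := shapiroLift_surjective (A.torsionGaloisModule ((2 ^ k : ℕ) : ℤ)).toTopRep (κ.layerSubgroup n)
    (κ.isOpen_layerSubgroup n) hs hs1 X
  have hXloc := (SelmerStructure.mem_selmerGroup_iff _ _).mp hX𝓖
  refine ⟨c, ?_, fun Q hQ => ?_⟩
  · -- admissibility of `c` (X ∈ H¹_𝓖: unramified outside `S`; (E1a/d))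
    refine admissible_of_forall_localization_shapiroLift_mem (A := A) (p := 2) (κ := κ) n k hs hs1 c fun w hw => ?_
    have hwS : (Sum.inr w : Place ℚ) ∉ S := fun h => hw ((hSinr w).mp h)
    have h1 := hXloc (Sum.inr w)
    rw [h𝓖.2 w hwS, ← hc] at h1
    exact h1
  · -- the pairing value: `⟨c, Q⟩_{n,2^k} = ⟨loc_v X, c_Q⟩_v = χ_z(c_Q) = 2^{m₀} z(Q) mod 2^k`
    have hQE : (⟨Q, signedLocalPointsOfEmb_le κ _ A 1 n hQ⟩ : localLayerPointsOfEmb κ ι A n) ∈ Eplus := hQ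
    rw [layerPairingMod_apply, ← cohomologyMap_coindFinPull_localization_shapiroLift A (2 ^ k) κ v hκ hv n hs hs1 c, ← hTpair, hc]
    exact (hXval _ ⟨⟨_, hQE⟩, rfl⟩).trans ((hχval ⟨_, hQE⟩).trans (hχ₀ ⟨_, hQE⟩))
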